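import Mathlib.RepresentationTheory.Coinvariants
import Summits.HodgeConjecture.HodgeCM.Model.WeilCentralCoinvariants_1   -- ★ `HodgeCM.TwistedCoinv.{ker, Coinv, mk, mk_ρW, rep, rep_mk, lift, lift_mk, ext_mk, …}`
import HarnessLib

/-!
# Crux `H413`, programme P2, N3 road (S4) — TWISTED COINVARIANTS AND `N`-COINVARIANTS COMMUTE
# (`(S ⧸ ⟨ρW h v − χ h v⟩)_N ≃ (S_N) ⧸ ⟨ρW♭ h x − χ h x⟩`, generator to generator, equivariantly)

Cell hodgecm-mathlib (D-0151), FLOOR 0, crux item H413 = stmt-HodgeConjecture-24833, programme P2; N3 road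
(`F0/P2/B-p18/g28/N3-ROAD.v1.B-p18g28.md`, K1 lead B-p18 (g28)) §2 step **(S4)**, ROW «N3-S4 GENERIC — TWIST ∕ COINVARIANTS COMMUTE»
(F0P2-plan (g8) 2026-08-31T18:45Z → seat F0P3a-p08 (g10)).  WHY: the N3 letter's clause (a) is about the Jacquet module
`r_N(X_v) = ((cmBorelTriple L 3 v).restrict X_v).Coinvariants` of Liu's local theta type
`X_v = (TwistedCoinv.rep χ_v (omegaLoc v) hc).comp localLineInl` (★ `CMThetaTypeVocabulary`), i.e. the `N`-coinvariants OF the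
`χ_{f,v}`-twisted coinvariants of the centre `U(W)`; the road computes the other order (the `Y ∕ N`-coinvariants of `ω` first —
★ p830834 (S1), ★ p831043 Schur, the (S3)-model — then the `χ`-part).  The swap is pure linear algebra; this file types it ONCE,
generically, in the DOCKING SHAPE OF LAWS: nothing is stated about `comp`-terms, only about representations satisfying the
generator laws `τ n [v] = [ρN n v]` (the `N`-action on the `χ`-coinvariants) and `ρW♭ h [v] = [ρW h v]` (the `H`-action on the
`N`-coinvariants), which the consumer discharges by `rfl` (★ `TwistedCoinv.rep_mk`, Mathlib `Representation.quotient_apply`).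

THEOREMS ONLY (no `def`, no instance, no notation, no named fact, no `sorry`); never imports a `Cruxes/…/Lines` module; kernel lane
`--supports stmt-HodgeConjecture-24833 --as helper`.  HC_CM is proved only modulo the 2 remaining named inputs (hLiu418, h413) until rung 0
closes; nothing printed is asserted here.

Binders (generic): a commutative ring `k`, groups `N`, `H` (and a «Levi» index group `M` in §4), one `k`-module `S` carrying
`ρN : Representation k N S`, `ρW : Representation k H S`, a character `χ : H →* kˣ`; `τ : Representation k N (TwistedCoinv.Coinv ρW χ)` with
the law `hτ`; `ρW♭ : Representation k H ρN.Coinvariants` with the law `hW♭`.  Notation of the docstrings: `[v]_W := TwistedCoinv.mk ρW χ v`,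
`[v]_N := Coinvariants.mk ρN v`, `[[v]] := Coinvariants.mk τ [v]_W`, `[[v]]♭ := TwistedCoinv.mk ρW♭ χ [v]_N`.

* §0 lawful actions EXIST: ★ `TwistedCoinv.rep χ ρN hc` ∕ `(TwistedCoinv.rep χ ρV hc).comp i` satisfy `hτ` (`rep_law`, `rep_comp_law`, `rfl`);
  `Coinvariants.ker ρN` is `ρW`-stable for commuting `ρN`, `ρW` (`coinvariantsKer_le_comap`), so Mathlib `ρW.quotient (Coinvariants.ker ρN) _` is a
  lawful `ρW♭` (`quotient_law`, `rfl`).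
* §1 HEAD (1) **`comap_mk_coinvariantsKer`**: `([·]_W)⁻¹ (Coinvariants.ker τ) = Coinvariants.ker ρN ⊔ TwistedCoinv.ker ρW χ`
  (via `coinvariantsKer_eq_map : Coinvariants.ker τ = (Coinvariants.ker ρN).map [·]_W`).
* §2 HEAD (2) **`comap_mk_twistedKer`**: `([·]_N)⁻¹ (TwistedCoinv.ker ρW♭ χ) = Coinvariants.ker ρN ⊔ TwistedCoinv.ker ρW χ` — the SAME submodule
  (via `twistedKer_eq_map : TwistedCoinv.ker ρW♭ χ = (TwistedCoinv.ker ρW χ).map [·]_N`).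
* §3 HEAD (3) THE SWAP **`exists_linearEquiv_swap`**: `∃ e : τ.Coinvariants ≃ₗ[k] TwistedCoinv.Coinv ρW♭ χ, (∀ v, e [[v]] = [[v]]♭) ∧ (∀ v, e.symm [[v]]♭ = [[v]])`
  (★ `TwistedCoinv.lift` and Mathlib `Coinvariants.lift` both ways; generator identities `rfl`), uniqueness `eq_of_mk_mk` ∕ `eq_of_mk_mk'`,
  double-generator surjectivity `mk_mk_surjective` ∕ `mk_mk_surjective'`.
* §4 HEAD (4) EQUIVARIANCE (what N3 (b), the torus weight, reads): endomorphisms `A` of `τ.Coinvariants`, `B` of `TwistedCoinv.Coinv ρW♭ χ` lying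
  over one `f : S →ₗ[k] S` (`A [[v]] = [[f v]]`, `B [[v]]♭ = [[f v]]♭`) are intertwined by ANY linear `e` with the §3 formula (**`comp_eq_comp_of_laws`**);
  `B = c • id` forces `A = c • id` for injective `e` (**`eq_smul_of_laws`**).  The descended «Levi» actions EXIST: a lawful
  `σ : Representation k M (TwistedCoinv.Coinv ρW χ)` over `ρM` preserving `Coinvariants.ker ρN` preserves `Coinvariants.ker τ`
  (`coinvariantsKer_le_comap_of_law`; Mathlib `σ.quotient (Coinvariants.ker τ) _` then acts on `τ.Coinvariants`, law `quotient_mk_mk`); lawful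
  descended `ρM♭`, `ρW♭` of commuting `ρM`, `ρW` commute (`commute_of_laws`; ★ `TwistedCoinv.rep χ ρM♭ _` acts on the swapped side, law
  `rep_mk_mk'`); `Coinvariants.ker (ρV.comp i)` is `ρV (j m)`-stable when `j(M)` normalises `i(N)` (`coinvariantsKer_comp_le_comap_of_normalises`).
[BernsteinZelevinsky1976, §2.30–2.33; MoeglinVignerasWaldspurger1987, Chap. 3 §IV; Liu2021, Def. 4.11.]

## References
* [BernsteinZelevinsky1976] I. N. Bernstein, A. V. Zelevinsky, *Representations of the group GL(n, F) where F is a non-archimedean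
  local field*, Russian Math. Surveys 31 (1976): §2.30–2.33.
* [MoeglinVignerasWaldspurger1987] C. Mœglin, M.-F. Vignéras, J.-L. Waldspurger, *Correspondances de Howe sur un corps p-adique*,
  LNM 1291 (1987): Chap. 3 §IV.
* [Liu2021] Y. Liu, *Fourier–Jacobi cycles and arithmetic relative trace formula*, Camb. J. Math. 9 (2021): Def. 4.11, App. D Lemma D.1.
-/

set_option autoImplicit false
set_option linter.dupNamespace false -- the mandated namespace repeats the single-problem summit's segment

noncomputable section

open HodgeCM Representation

namespace Summit.HodgeConjecture.HodgeConjecture.Cruxes.H413.F0P2oTwistCoinvariantsCommute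

variable {k : Type*} [CommRing k] {G H N M S : Type*} [Group G] [Group H] [Group N] [Group M]
  [AddCommGroup S] [Module k S]

/-! ## §0 Existence of the lawful actions -/

section Laws

variable (ρN : Representation k N S) (ρW : Representation k H S) (χ : H →* kˣ)

/-- ★ `TwistedCoinv.rep χ ρN hc` (the `N`-action on the `χ`-coinvariants of commuting `ρN`, `ρW`) satisfies the law `τ n [v]_W = [ρN n v]_W`
(this is ★ `TwistedCoinv.rep_mk`, by `rfl`). [cite: Liu2021, Def. 4.11] -/
theorem rep_law (hc : ∀ (n : N) (h : H), Commute (ρN n) (ρW h)) (n : N) (v : S) :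
    TwistedCoinv.rep χ ρN hc n (TwistedCoinv.mk ρW χ v) = TwistedCoinv.mk ρW χ (ρN n v) :=
  rfl

/-- the law for a restricted action: `((TwistedCoinv.rep χ ρV hc).comp i) n [v]_W = [(ρV.comp i) n v]_W` (by `rfl`) — the shape of
`t.restrict X_v` for Liu's theta type `X_v = (TwistedCoinv.rep χ ω hc).comp localLineInl`. [cite: Liu2021, Def. 4.11] -/
theorem rep_comp_law (ρV : Representation k G S) (hc : ∀ (g : G) (h : H), Commute (ρV g) (ρW h)) (i : N →* G) (n : N) (v : S) :
    (TwistedCoinv.rep χ ρV hc).comp i n (TwistedCoinv.mk ρW χ v) = TwistedCoinv.mk ρW χ (ρV.comp i n v) :=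
  rfl

/-- **the relation submodule `⟨ρN n v − v⟩` of the `N`-coinvariants is `ρW`-stable** when `ρN`, `ρW` commute — so the `H`-action DESCENDS to
`ρN.Coinvariants` (Mathlib `ρW.quotient (Coinvariants.ker ρN) (coinvariantsKer_le_comap ρN ρW hc)`). [cite: BernsteinZelevinsky1976, §2.30–2.33] -/
theorem coinvariantsKer_le_comap (hc : ∀ (n : N) (h : H), Commute (ρN n) (ρW h)) (h : H) :
    Coinvariants.ker ρN ≤ (Coinvariants.ker ρN).comap (ρW h) := by
  rw [Coinvariants.ker, Submodule.span_le]
  rintro _ ⟨⟨n, v⟩, rfl⟩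
  have hcomm : ρW h (ρN n v) = ρN n (ρW h v) := by
    simpa only [Module.End.mul_apply] using (LinearMap.congr_fun (hc n h).eq v).symm
  rw [SetLike.mem_coe, Submodule.mem_comap, map_sub, hcomm]
  exact Coinvariants.sub_mem_ker n (ρW h v)

/-- the descended `H`-action `ρW♭ := ρW.quotient (Coinvariants.ker ρN) _` satisfies the law `ρW♭ h [v]_N = [ρW h v]_N` (by `rfl`). [cite: BernsteinZelevinsky1976, §2.30–2.33] -/
theorem quotient_law (hc : ∀ (n : N) (h : H), Commute (ρN n) (ρW h)) (h : H) (v : S) :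
    ρW.quotient (Coinvariants.ker ρN) (coinvariantsKer_le_comap ρN ρW hc) h (Coinvariants.mk ρN v) =
      Coinvariants.mk ρN (ρW h v) :=
  rfl

end Laws

/-! ## §1 HEAD (1): the kernel of `[v]_W ↦ [[v]]` pulled back to `S` -/

section KernelOne

variable (ρN : Representation k N S) (ρW : Representation k H S) (χ : H →* kˣ)
  (τ : Representation k N (TwistedCoinv.Coinv ρW χ))
  (hτ : ∀ (n : N) (v : S), τ n (TwistedCoinv.mk ρW χ v) = TwistedCoinv.mk ρW χ (ρN n v))

/-- the kernel of ★ `TwistedCoinv.mk` is ★ `TwistedCoinv.ker` (Mathlib `Submodule.ker_mkQ`). [cite: MoeglinVignerasWaldspurger1987, Chap. 3 §IV] -/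
theorem ker_twistedMk : LinearMap.ker (TwistedCoinv.mk ρW χ) = TwistedCoinv.ker ρW χ :=
  Submodule.ker_mkQ _

/-- the kernel of Mathlib's `Coinvariants.mk` is `Coinvariants.ker` (Mathlib `Submodule.ker_mkQ`). [cite: BernsteinZelevinsky1976, §2.30–2.33] -/
theorem ker_coinvariantsMk : LinearMap.ker (Coinvariants.mk ρN) = Coinvariants.ker ρN :=
  Submodule.ker_mkQ _

include hτ in
/-- a generator of `Coinvariants.ker τ` is the image of a generator of `Coinvariants.ker ρN`: `τ n [v]_W − [v]_W = [ρN n v − v]_W`. [cite: BernsteinZelevinsky1976, §2.30–2.33] -/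
theorem rep_mk_sub_mk (n : N) (v : S) :
    τ n (TwistedCoinv.mk ρW χ v) - TwistedCoinv.mk ρW χ v = TwistedCoinv.mk ρW χ (ρN n v - v) := by
  rw [map_sub, hτ]

include hτ in
/-- **`Coinvariants.ker τ = (Coinvariants.ker ρN).map [·]_W`**: the relation submodule of the `N`-coinvariants of the `χ`-coinvariants is the
image of the relation submodule of the `N`-coinvariants of `S`. [cite: BernsteinZelevinsky1976, §2.30–2.33] -/
theorem coinvariantsKer_eq_map :
    Coinvariants.ker τ = (Coinvariants.ker ρN).map (TwistedCoinv.mk ρW χ) := by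
  refine le_antisymm ?_ ?_
  · rw [Coinvariants.ker, Submodule.span_le]
    rintro _ ⟨⟨n, y⟩, rfl⟩
    obtain ⟨v, rfl⟩ := TwistedCoinv.mk_surjective ρW χ y
    refine ⟨ρN n v - v, Coinvariants.sub_mem_ker n v, ?_⟩
    exact (rep_mk_sub_mk ρN ρW χ τ hτ n v).symm
  · rw [Submodule.map_le_iff_le_comap, Coinvariants.ker, Submodule.span_le]
    rintro _ ⟨⟨n, v⟩, rfl⟩
    rw [SetLike.mem_coe, Submodule.mem_comap]
    exact Coinvariants.mem_ker_of_eq n (TwistedCoinv.mk ρW χ v) _ (rep_mk_sub_mk ρN ρW χ τ hτ n v)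

include hτ in
/-- **HEAD (1)** — `([·]_W)⁻¹ (Coinvariants.ker τ) = Coinvariants.ker ρN ⊔ TwistedCoinv.ker ρW χ`: the kernel of the double quotient map
`S → τ.Coinvariants`, `v ↦ [[v]]`, is generated by the `N`-relations and the `χ`-relations together. [cite: BernsteinZelevinsky1976, §2.30–2.33] -/
theorem comap_mk_coinvariantsKer :
    (Coinvariants.ker τ).comap (TwistedCoinv.mk ρW χ) = Coinvariants.ker ρN ⊔ TwistedCoinv.ker ρW χ := by
  rw [coinvariantsKer_eq_map ρN ρW χ τ hτ, Submodule.comap_map_eq, ker_twistedMk]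

include hτ in
/-- the kernel of the composite `[[·]] = Coinvariants.mk τ ∘ [·]_W : S → τ.Coinvariants` as a `LinearMap.ker`. [cite: BernsteinZelevinsky1976, §2.30–2.33] -/
theorem ker_mk_comp_mk :
    LinearMap.ker (Coinvariants.mk τ ∘ₗ TwistedCoinv.mk ρW χ) = Coinvariants.ker ρN ⊔ TwistedCoinv.ker ρW χ := by
  rw [LinearMap.ker_comp, ker_coinvariantsMk, comap_mk_coinvariantsKer ρN ρW χ τ hτ]

end KernelOne

/-! ## §2 HEAD (2): the kernel of `[v]_N ↦ [[v]]♭` pulled back to `S` -/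

section KernelTwo

variable (ρN : Representation k N S) (ρW : Representation k H S) (χ : H →* kˣ)
  (ρW' : Representation k H ρN.Coinvariants)
  (hW' : ∀ (h : H) (v : S), ρW' h (Coinvariants.mk ρN v) = Coinvariants.mk ρN (ρW h v))

include hW' in
/-- a generator of `TwistedCoinv.ker ρW♭ χ` is the image of a generator of `TwistedCoinv.ker ρW χ`: `ρW♭ h [v]_N − χ h • [v]_N = [ρW h v − χ h • v]_N`. [cite: MoeglinVignerasWaldspurger1987, Chap. 3 §IV] -/
theorem quotient_mk_sub_smul_mk (h : H) (v : S) :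
    ρW' h (Coinvariants.mk ρN v) - ((χ h : kˣ) : k) • Coinvariants.mk ρN v = Coinvariants.mk ρN (ρW h v - ((χ h : kˣ) : k) • v) := by
  rw [map_sub, map_smul, hW']

include hW' in
/-- **`TwistedCoinv.ker ρW♭ χ = (TwistedCoinv.ker ρW χ).map [·]_N`**: the `χ`-relation submodule of the descended `H`-action on the `N`-coinvariants is
the image of the `χ`-relation submodule of `S`. [cite: MoeglinVignerasWaldspurger1987, Chap. 3 §IV] -/
theorem twistedKer_eq_map :
    TwistedCoinv.ker ρW' χ = (TwistedCoinv.ker ρW χ).map (Coinvariants.mk ρN) := by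
  refine le_antisymm ?_ ?_
  · rw [TwistedCoinv.ker, Submodule.span_le]
    rintro _ ⟨⟨h, y⟩, rfl⟩
    obtain ⟨v, rfl⟩ := Coinvariants.mk_surjective ρN y
    refine ⟨ρW h v - ((χ h : kˣ) : k) • v, TwistedCoinv.sub_mem_ker ρW χ h v, ?_⟩
    exact (quotient_mk_sub_smul_mk ρN ρW χ ρW' hW' h v).symm
  · rw [Submodule.map_le_iff_le_comap, TwistedCoinv.ker, Submodule.span_le]
    rintro _ ⟨⟨h, v⟩, rfl⟩
    rw [SetLike.mem_coe, Submodule.mem_comap]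
    show Coinvariants.mk ρN (ρW h v - ((χ h : kˣ) : k) • v) ∈ TwistedCoinv.ker ρW' χ
    rw [← quotient_mk_sub_smul_mk ρN ρW χ ρW' hW' h v]
    exact TwistedCoinv.sub_mem_ker ρW' χ h (Coinvariants.mk ρN v)

include hW' in
/-- **HEAD (2)** — `([·]_N)⁻¹ (TwistedCoinv.ker ρW♭ χ) = Coinvariants.ker ρN ⊔ TwistedCoinv.ker ρW χ`: the kernel of the double quotient map
`S → TwistedCoinv.Coinv ρW♭ χ`, `v ↦ [[v]]♭`, is the SAME submodule as in HEAD (1). [cite: MoeglinVignerasWaldspurger1987, Chap. 3 §IV] -/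
theorem comap_mk_twistedKer :
    (TwistedCoinv.ker ρW' χ).comap (Coinvariants.mk ρN) = Coinvariants.ker ρN ⊔ TwistedCoinv.ker ρW χ := by
  rw [twistedKer_eq_map ρN ρW χ ρW' hW', Submodule.comap_map_eq, ker_coinvariantsMk, sup_comm]

include hW' in
/-- the kernel of the composite `[[·]]♭ = [·]_{W♭} ∘ Coinvariants.mk ρN : S → TwistedCoinv.Coinv ρW♭ χ` as a `LinearMap.ker`. [cite: MoeglinVignerasWaldspurger1987, Chap. 3 §IV] -/
theorem ker_mk_comp_mk' :
    LinearMap.ker (TwistedCoinv.mk ρW' χ ∘ₗ Coinvariants.mk ρN) = Coinvariants.ker ρN ⊔ TwistedCoinv.ker ρW χ := by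
  rw [LinearMap.ker_comp, ker_twistedMk, comap_mk_twistedKer ρN ρW χ ρW' hW']

end KernelTwo

/-! ## §3 HEAD (3): the swap `τ.Coinvariants ≃ₗ[k] TwistedCoinv.Coinv ρW♭ χ`, generator to generator -/

section Swap

variable (ρN : Representation k N S) (ρW : Representation k H S) (χ : H →* kˣ)
  (τ : Representation k N (TwistedCoinv.Coinv ρW χ))
  (hτ : ∀ (n : N) (v : S), τ n (TwistedCoinv.mk ρW χ v) = TwistedCoinv.mk ρW χ (ρN n v))
  (ρW' : Representation k H ρN.Coinvariants)
  (hW' : ∀ (h : H) (v : S), ρW' h (Coinvariants.mk ρN v) = Coinvariants.mk ρN (ρW h v))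

/-- **double-generator surjectivity** on the `τ` side: every element of `τ.Coinvariants` is a `[[v]]`. [cite: BernsteinZelevinsky1976, §2.30–2.33] -/
theorem mk_mk_surjective : Function.Surjective fun v : S => Coinvariants.mk τ (TwistedCoinv.mk ρW χ v) :=
  (Coinvariants.mk_surjective τ).comp (TwistedCoinv.mk_surjective ρW χ)

/-- **double-generator surjectivity** on the swapped side: every element of `TwistedCoinv.Coinv ρW♭ χ` is a `[[v]]♭`. [cite: MoeglinVignerasWaldspurger1987, Chap. 3 §IV] -/
theorem mk_mk_surjective' : Function.Surjective fun v : S => TwistedCoinv.mk ρW' χ (Coinvariants.mk ρN v) :=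
  (TwistedCoinv.mk_surjective ρW' χ).comp (Coinvariants.mk_surjective ρN)

variable {X : Type*} [AddCommGroup X] [Module k X]

/-- **uniqueness on the `τ` side**: two linear maps out of `τ.Coinvariants` agreeing on every `[[v]]` are equal. [cite: BernsteinZelevinsky1976, §2.30–2.33] -/
theorem eq_of_mk_mk {f g : τ.Coinvariants →ₗ[k] X}
    (hfg : ∀ v : S, f (Coinvariants.mk τ (TwistedCoinv.mk ρW χ v)) = g (Coinvariants.mk τ (TwistedCoinv.mk ρW χ v))) : f = g :=
  Coinvariants.hom_ext (TwistedCoinv.ext_mk ρW χ hfg)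

/-- **uniqueness on the swapped side**: two linear maps out of `TwistedCoinv.Coinv ρW♭ χ` agreeing on every `[[v]]♭` are equal. [cite: MoeglinVignerasWaldspurger1987, Chap. 3 §IV] -/
theorem eq_of_mk_mk' {f g : TwistedCoinv.Coinv ρW' χ →ₗ[k] X}
    (hfg : ∀ v : S, f (TwistedCoinv.mk ρW' χ (Coinvariants.mk ρN v)) = g (TwistedCoinv.mk ρW' χ (Coinvariants.mk ρN v))) : f = g :=
  TwistedCoinv.ext_mk ρW' χ fun x => by
    obtain ⟨v, rfl⟩ := Coinvariants.mk_surjective ρN x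
    exact hfg v

include hW' in
/-- the map `v ↦ [[v]]♭` transforms under `ρW` by `χ` (so it factors through `[·]_W`, ★ `TwistedCoinv.lift`). [cite: MoeglinVignerasWaldspurger1987, Chap. 3 §IV] -/
theorem mk_mk_ρW' (h : H) (v : S) :
    (TwistedCoinv.mk ρW' χ ∘ₗ Coinvariants.mk ρN) (ρW h v) = ((χ h : kˣ) : k) • (TwistedCoinv.mk ρW' χ ∘ₗ Coinvariants.mk ρN) v := by
  rw [LinearMap.comp_apply, LinearMap.comp_apply, ← hW', TwistedCoinv.mk_ρW]

include hτ in
/-- the map `v ↦ [[v]]` is `ρN`-invariant (so it factors through `[·]_N`, Mathlib `Coinvariants.lift`). [cite: BernsteinZelevinsky1976, §2.30–2.33] -/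
theorem mk_mk_comp_ρN (n : N) :
    (Coinvariants.mk τ ∘ₗ TwistedCoinv.mk ρW χ) ∘ₗ ρN n = Coinvariants.mk τ ∘ₗ TwistedCoinv.mk ρW χ := by
  refine LinearMap.ext fun v => ?_
  rw [LinearMap.comp_apply, LinearMap.comp_apply, LinearMap.comp_apply, ← hτ]
  exact Coinvariants.mk_self_apply τ n _

include hτ hW' in
/-- **HEAD (3) — THE SWAP**: `τ.Coinvariants ≃ₗ[k] TwistedCoinv.Coinv ρW♭ χ` with `e [[v]] = [[v]]♭` and `e.symm [[v]]♭ = [[v]]` for every `v : S` — the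
`N`-coinvariants of the `χ`-coinvariants ARE the `χ`-coinvariants of the `N`-coinvariants (both are `S ⧸ (Coinvariants.ker ρN ⊔ TwistedCoinv.ker ρW χ)`,
HEADS (1)(2)); built from ★ `TwistedCoinv.lift` and Mathlib `Coinvariants.lift` in both directions. [cite: BernsteinZelevinsky1976, §2.30–2.33] [cite: MoeglinVignerasWaldspurger1987, Chap. 3 §IV] -/
theorem exists_linearEquiv_swap :
    ∃ e : τ.Coinvariants ≃ₗ[k] TwistedCoinv.Coinv ρW' χ,
      (∀ v : S, e (Coinvariants.mk τ (TwistedCoinv.mk ρW χ v)) = TwistedCoinv.mk ρW' χ (Coinvariants.mk ρN v)) ∧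
      (∀ v : S, e.symm (TwistedCoinv.mk ρW' χ (Coinvariants.mk ρN v)) = Coinvariants.mk τ (TwistedCoinv.mk ρW χ v)) := by
  -- forward: `S → Coinv ρW♭ χ` factors through `[·]_W` (transforms by `χ`) and then through `Coinvariants.mk τ` (`N`-invariant)
  let f₁ : TwistedCoinv.Coinv ρW χ →ₗ[k] TwistedCoinv.Coinv ρW' χ :=
    TwistedCoinv.lift ρW χ (TwistedCoinv.mk ρW' χ ∘ₗ Coinvariants.mk ρN) (mk_mk_ρW' ρN ρW χ ρW' hW')
  have hf₁ : ∀ n : N, f₁ ∘ₗ τ n = f₁ := fun n =>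
    TwistedCoinv.ext_mk ρW χ fun v => by
      show f₁ (τ n (TwistedCoinv.mk ρW χ v)) = f₁ (TwistedCoinv.mk ρW χ v)
      rw [hτ]
      show TwistedCoinv.mk ρW' χ (Coinvariants.mk ρN (ρN n v)) = TwistedCoinv.mk ρW' χ (Coinvariants.mk ρN v)
      rw [Coinvariants.mk_self_apply]
  let F : τ.Coinvariants →ₗ[k] TwistedCoinv.Coinv ρW' χ := Coinvariants.lift τ f₁ hf₁
  -- backward: `S → τ.Coinvariants` factors through `[·]_N` (`N`-invariant) and then through `[·]_{W♭}` (transforms by `χ`)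
  let g₁ : ρN.Coinvariants →ₗ[k] τ.Coinvariants :=
    Coinvariants.lift ρN (Coinvariants.mk τ ∘ₗ TwistedCoinv.mk ρW χ) (mk_mk_comp_ρN ρN ρW χ τ hτ)
  have hg₁ : ∀ (h : H) (x : ρN.Coinvariants), g₁ (ρW' h x) = ((χ h : kˣ) : k) • g₁ x := fun h x => by
    obtain ⟨v, rfl⟩ := Coinvariants.mk_surjective ρN x
    rw [hW']
    show Coinvariants.mk τ (TwistedCoinv.mk ρW χ (ρW h v)) = ((χ h : kˣ) : k) • Coinvariants.mk τ (TwistedCoinv.mk ρW χ v)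
    rw [TwistedCoinv.mk_ρW, map_smul]
  let B : TwistedCoinv.Coinv ρW' χ →ₗ[k] τ.Coinvariants := TwistedCoinv.lift ρW' χ g₁ hg₁
  have hFB : F ∘ₗ B = LinearMap.id := eq_of_mk_mk' ρN χ ρW' fun v => rfl
  have hBF : B ∘ₗ F = LinearMap.id := eq_of_mk_mk ρW χ τ fun v => rfl
  exact ⟨LinearEquiv.ofLinear F B hFB hBF, fun v => rfl, fun v => rfl⟩

include hτ hW' in
/-- the swap as a bare existence of a linear equivalence with the forward formula (the form `Nonempty`-valued consumers quote). [cite: BernsteinZelevinsky1976, §2.30–2.33] -/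
theorem exists_linearEquiv_swap' :
    ∃ e : τ.Coinvariants ≃ₗ[k] TwistedCoinv.Coinv ρW' χ,
      ∀ v : S, e (Coinvariants.mk τ (TwistedCoinv.mk ρW χ v)) = TwistedCoinv.mk ρW' χ (Coinvariants.mk ρN v) := by
  obtain ⟨e, he, -⟩ := exists_linearEquiv_swap ρN ρW χ τ hτ ρW' hW'
  exact ⟨e, he⟩

end Swap

/-! ## §4 HEAD (4): equivariance of the swap for «Levi» actions lying over one endomorphism of `S` -/

section Equivariance

variable (ρN : Representation k N S) (ρW : Representation k H S) (χ : H →* kˣ)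
  (τ : Representation k N (TwistedCoinv.Coinv ρW χ))
  (ρW' : Representation k H ρN.Coinvariants)

/-- **HEAD (4) — EQUIVARIANCE IN GENERATOR FORM**: if `A` on `τ.Coinvariants` and `B` on `TwistedCoinv.Coinv ρW♭ χ` lie over one `f : S →ₗ[k] S`
(`A [[v]] = [[f v]]`, `B [[v]]♭ = [[f v]]♭`), then EVERY linear `e` with `e [[v]] = [[v]]♭` satisfies `e ∘ A = B ∘ e`.  (Feed `A :=` the Jacquet-module
action `X_v.jacquetModule t m` — law ★ `jacquetModule_mk` + ★ `TwistedCoinv.rep_mk` — and `B :=` the model-side action.) [cite: BernsteinZelevinsky1976, §2.30–2.33] -/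
theorem comp_eq_comp_of_laws (e : τ.Coinvariants →ₗ[k] TwistedCoinv.Coinv ρW' χ)
    (he : ∀ v : S, e (Coinvariants.mk τ (TwistedCoinv.mk ρW χ v)) = TwistedCoinv.mk ρW' χ (Coinvariants.mk ρN v))
    (f : S →ₗ[k] S) (A : τ.Coinvariants →ₗ[k] τ.Coinvariants) (B : TwistedCoinv.Coinv ρW' χ →ₗ[k] TwistedCoinv.Coinv ρW' χ)
    (hA : ∀ v : S, A (Coinvariants.mk τ (TwistedCoinv.mk ρW χ v)) = Coinvariants.mk τ (TwistedCoinv.mk ρW χ (f v)))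
    (hB : ∀ v : S, B (TwistedCoinv.mk ρW' χ (Coinvariants.mk ρN v)) = TwistedCoinv.mk ρW' χ (Coinvariants.mk ρN (f v))) :
    e ∘ₗ A = B ∘ₗ e :=
  eq_of_mk_mk ρW χ τ fun v => by rw [LinearMap.comp_apply, LinearMap.comp_apply, hA, he, he, hB]

/-- **the torus-weight corollary** (what N3 (b) reads): if the model-side operator over `f` is the SCALAR `c` (`[[f v]]♭ = c • [[v]]♭`) and `e` is
injective, then the operator over `f` on `τ.Coinvariants` is the same scalar: `A = c • id`. [cite: BernsteinZelevinsky1976, §2.30–2.33] -/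
theorem eq_smul_of_laws (e : τ.Coinvariants →ₗ[k] TwistedCoinv.Coinv ρW' χ) (hinj : Function.Injective e)
    (he : ∀ v : S, e (Coinvariants.mk τ (TwistedCoinv.mk ρW χ v)) = TwistedCoinv.mk ρW' χ (Coinvariants.mk ρN v))
    (f : S →ₗ[k] S) (c : k) (A : τ.Coinvariants →ₗ[k] τ.Coinvariants)
    (hA : ∀ v : S, A (Coinvariants.mk τ (TwistedCoinv.mk ρW χ v)) = Coinvariants.mk τ (TwistedCoinv.mk ρW χ (f v)))
    (hc : ∀ v : S, TwistedCoinv.mk ρW' χ (Coinvariants.mk ρN (f v)) = c • TwistedCoinv.mk ρW' χ (Coinvariants.mk ρN v)) :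
    A = c • LinearMap.id := by
  refine eq_of_mk_mk ρW χ τ fun v => hinj ?_
  rw [hA, he, hc, LinearMap.smul_apply, LinearMap.id_apply, map_smul, he]

/-! ### Existence of the descended «Levi» actions -/

variable (hτ : ∀ (n : N) (v : S), τ n (TwistedCoinv.mk ρW χ v) = TwistedCoinv.mk ρW χ (ρN n v))
  (hW' : ∀ (h : H) (v : S), ρW' h (Coinvariants.mk ρN v) = Coinvariants.mk ρN (ρW h v))
  (ρM : Representation k M S)

include hτ in
/-- **the descended action EXISTS on the `τ` side**: a lawful `σ : Representation k M (TwistedCoinv.Coinv ρW χ)` over `ρM` (`σ m [v]_W = [ρM m v]_W`,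
e.g. ★ `TwistedCoinv.rep χ ρM hMW`) with `ρM` preserving `Coinvariants.ker ρN` preserves `Coinvariants.ker τ` — so Mathlib
`σ.quotient (Coinvariants.ker τ) (coinvariantsKer_le_comap_of_law …)` is an `M`-action on `τ.Coinvariants` with law `[[ρM m v]]`. [cite: BernsteinZelevinsky1976, §2.30–2.33] -/
theorem coinvariantsKer_le_comap_of_law (σ : Representation k M (TwistedCoinv.Coinv ρW χ))
    (hσ : ∀ (m : M) (v : S), σ m (TwistedCoinv.mk ρW χ v) = TwistedCoinv.mk ρW χ (ρM m v))
    (hMN : ∀ m : M, Coinvariants.ker ρN ≤ (Coinvariants.ker ρN).comap (ρM m)) (m : M) :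
    Coinvariants.ker τ ≤ (Coinvariants.ker τ).comap (σ m) := by
  rw [coinvariantsKer_eq_map ρN ρW χ τ hτ, Submodule.map_le_iff_le_comap]
  intro x hx
  rw [Submodule.mem_comap, Submodule.mem_comap, hσ]
  exact Submodule.mem_map_of_mem (hMN m hx)

include hτ in
/-- the law of the quotient action on `τ.Coinvariants`: `(σ.quotient (Coinvariants.ker τ) _) m [[v]] = [[ρM m v]]` (by the law of `σ`). [cite: BernsteinZelevinsky1976, §2.30–2.33] -/
theorem quotient_mk_mk (σ : Representation k M (TwistedCoinv.Coinv ρW χ))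
    (hσ : ∀ (m : M) (v : S), σ m (TwistedCoinv.mk ρW χ v) = TwistedCoinv.mk ρW χ (ρM m v))
    (hMN : ∀ m : M, Coinvariants.ker ρN ≤ (Coinvariants.ker ρN).comap (ρM m)) (m : M) (v : S) :
    σ.quotient (Coinvariants.ker τ) (coinvariantsKer_le_comap_of_law ρN ρW χ τ hτ ρM σ hσ hMN) m
        (Coinvariants.mk τ (TwistedCoinv.mk ρW χ v)) =
      Coinvariants.mk τ (TwistedCoinv.mk ρW χ (ρM m v)) := by
  rw [← hσ]
  rfl

include hW' in
/-- **the descended actions COMMUTE on the swapped side**: lawful `ρM♭` over `ρM` and `ρW♭` over `ρW` commute on `ρN.Coinvariants` as soon as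
`ρM`, `ρW` commute on `S` — so ★ `TwistedCoinv.rep χ ρM♭ (commute_of_laws …)` is the `M`-action on `TwistedCoinv.Coinv ρW♭ χ`, with law `[[ρM m v]]♭`
(★ `TwistedCoinv.rep_mk`). [cite: MoeglinVignerasWaldspurger1987, Chap. 3 §IV] -/
theorem commute_of_laws (hMW : ∀ (m : M) (h : H), Commute (ρM m) (ρW h)) (ρM' : Representation k M ρN.Coinvariants)
    (hM' : ∀ (m : M) (v : S), ρM' m (Coinvariants.mk ρN v) = Coinvariants.mk ρN (ρM m v)) (m : M) (h : H) :
    Commute (ρM' m) (ρW' h) := by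
  refine Commute.symm (LinearMap.ext fun x => ?_)
  obtain ⟨v, rfl⟩ := Coinvariants.mk_surjective ρN x
  have hcomm : ρW h (ρM m v) = ρM m (ρW h v) := by
    simpa only [Module.End.mul_apply] using (LinearMap.congr_fun (hMW m h).eq v).symm
  rw [Module.End.mul_apply, Module.End.mul_apply, hM', hW', hW', hM', hcomm]

/-- the law of ★ `TwistedCoinv.rep` on the swapped side, spelled on double generators: `TwistedCoinv.rep χ ρM♭ hc♭ m [[v]]♭ = [[ρM m v]]♭`. [cite: MoeglinVignerasWaldspurger1987, Chap. 3 §IV] -/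
theorem rep_mk_mk' (ρM' : Representation k M ρN.Coinvariants)
    (hM' : ∀ (m : M) (v : S), ρM' m (Coinvariants.mk ρN v) = Coinvariants.mk ρN (ρM m v))
    (hc' : ∀ (m : M) (h : H), Commute (ρM' m) (ρW' h)) (m : M) (v : S) :
    TwistedCoinv.rep χ ρM' hc' m (TwistedCoinv.mk ρW' χ (Coinvariants.mk ρN v)) =
      TwistedCoinv.mk ρW' χ (Coinvariants.mk ρN (ρM m v)) := by
  rw [TwistedCoinv.rep_mk, hM']

/-- **Mathlib's descended Levi action is lawful**: `ρM.quotient (Coinvariants.ker ρN) hMN m [v]_N = [ρM m v]_N` (by `rfl`). [cite: BernsteinZelevinsky1976, §2.30–2.33] -/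
theorem quotient_law' (hMN : ∀ m : M, Coinvariants.ker ρN ≤ (Coinvariants.ker ρN).comap (ρM m)) (m : M) (v : S) :
    ρM.quotient (Coinvariants.ker ρN) hMN m (Coinvariants.mk ρN v) = Coinvariants.mk ρN (ρM m v) :=
  rfl

/-- **a normalising action preserves the `N`-relations**: if `j(M)` normalises `i(N)` inside `G` (`j m · i n · (j m)⁻¹ = i n′`) then `ρV (j m)` preserves
`Coinvariants.ker (ρV.comp i)` — the Levi of a parabolic triple normalises its unipotent radical, so `ρM := ρV.comp j` meets `hMN`. [cite: BernsteinZelevinsky1976, §2.30–2.33] -/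
theorem coinvariantsKer_comp_le_comap_of_normalises (ρV : Representation k G S) (i : N →* G) (j : M →* G)
    (hnorm : ∀ (m : M) (n : N), ∃ n' : N, j m * i n * (j m)⁻¹ = i n') (m : M) :
    Coinvariants.ker (ρV.comp i) ≤ (Coinvariants.ker (ρV.comp i)).comap (ρV (j m)) := by
  rw [Coinvariants.ker, Submodule.span_le]
  rintro _ ⟨⟨n, v⟩, rfl⟩
  obtain ⟨n', hn'⟩ := hnorm m n
  have key : ρV (j m) (ρV (i n) v) = ρV (i n') (ρV (j m) v) := by
    rw [← hn', map_mul, map_mul, Module.End.mul_apply, Module.End.mul_apply, ← Module.End.mul_apply (f := ρV (j m)⁻¹),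
      ← map_mul, inv_mul_cancel, map_one, Module.End.one_apply]
  show ρV (j m) (ρV (i n) v - v) ∈ Coinvariants.ker (ρV.comp i)
  rw [map_sub, key]
  exact Coinvariants.sub_mem_ker (ρ := ρV.comp i) n' (ρV (j m) v)

end Equivariance

end Summit.HodgeConjecture.HodgeConjecture.Cruxes.H413.F0P2oTwistCoinvariantsCommute

end
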